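import Summits.BirchSwinnertonDyer.BirchSwinnertonDyer.Theorems.ByReductionTypeAtTwoFineSelmerConjAAtTwoAdditivePotGoodAscentStampsA
import HarnessLib

/-!
# C4″ `AdditivePotMultOverKAtTwo` (item stmt-BirchSwinnertonDyer-22618), the (I1M′) input of the upper half on the `Δ < 0` rows:
# KERNEL STAMPS, part S — Iwasawa's `μ₂ = 0` (ZERO hypotheses) for the `2`-torsion cubic fields `d = -756`, `d = -2420` and UNCONDITIONAL
# statement (A) at `2` for the C4″ census curves 205632cw1, 193600fd1

Cell `bsd-2adic`, rung K4, seat `bsd-2adic-k4-w3` GEN 11 (explicit unit of director-bsd g16 (309)(7); `--supports stmt-BirchSwinnertonDyer-22618`).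
HONEST FRAMING (D-0036/D-0054/D-0152): THEOREMS ONLY (no definition, no named fact, no `sorry`). FIELD PART (unconditional kernel arithmetic about an
explicit cubic field `ℚ(θ)`; generator = eng-2's polredabs cubic when its index `[𝓞 : ℤ[θ]]` is odd, else an odd-index second generator):
`irreducible_cubic_<d>`, `odd_classNumber_of_root_<d>` (norm certificate below the Minkowski bound; k4-w1's `odd_classNumber_of_cubeCertificate`),
**`classicalMu_two_cubicField_<d>`** = `μ = 0` (growth form) along EVERY cyclotomic `ℤ₂`-extension of `ℚ(θ)` from `e₀ = 0` (odd `h`), `e₁ = 0` (k4-w1's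
Chevalley door at `2`, `layerOneBit_of_chevalleyCert`: a unit with `2`-adic image `≡ ±3 (mod 8)` is not a norm from `ℚ(θ, √2)`; ≤ 2 primes above `2`),
`n₀ = 0` (odd cubic discriminant `…_of_odd_cubic_discr`, or `2 = 𝔭𝔮²` with an even-index certificate `…_of_evenIndexCertificate`) and Fukuda 1994 Thm. 1 (1)
(`_holds`). These fields have TWO primes above `2` (the `2`-division cubic of a potentially multiplicative curve has a `ℚ₂`-root). ROW PART:
`conjA_two_<L>'` = Coates–Sujatha's statement (A) at `p = 2` for the census cubic model of the Cremona class (a-invariants of addL2x GEN 13's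
`nst_census-j313647.tsv`), PROVED OUTRIGHT: field identification `ℚ(β) = ℚ(θ)` + cruxlead-19573-w2's door
`TotallyComplexMu.conjA_two_cubicModel_of_classicalMu_of_discr_neg` (kernel Lim 3.5@2 + `ℓ = 2` ascent). Certificates (norm witnesses, fundamental units by a
relation sieve, Hensel data, even-index elements) found by the seat's exact-arithmetic tools (`work/tools/`) and CHECKED HERE by the kernel; eng-2's
census CERT-ADD-POTMULT-FUKUDA269-E2 agrees (`μ₂ = λ₂ = 0`, bnfcertify). Statement (A) is NOT BSD: BSD₂ for these curves is not proved; C4″ / (I1M′) stay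
research-open; nothing booked; no row of 22618 changes tier (pen RC-490 (4)). Pattern/toolkit: k4-w1 GEN 5–8 (`…MuTwoKernelRows{A,B}`, `…AscentStampsA`).

References: [CoatesSujatha2005] Conj. A, Thm. 3.4; [Iwasawa1973MuInvariants] Thm. 2/3; [Fukuda1994] Thm. 1 (1); [Lang1990] Ch. 13 §4 Lemma 4.1;
[Washington1997] §13.1; [Marcus1977] Ch. 5 Thm. 35–37; [Cohen1993] §6.3; [Lim2017FineSelmer] §3; cell files `eng2/fukuda269/{TABLE,LAYERS}-…-E2-v1.tsv`.
-/

set_option autoImplicit false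
-- sibling precedent (`…MuTwoKernelRowsA.lean`): the directory name repeats the summit name
set_option linter.dupNamespace false

noncomputable section
open scoped Classical IntermediateField NumberField Real nonZeroDivisors
namespace Summit.BirchSwinnertonDyer.BirchSwinnertonDyer.Theorems.AddKatoTwo
open WeierstrassCurve Field Polynomial IsDedekindDomain NumberField Matrix Literature.NumberTheory.EllipticCurves
  Literature.NumberTheory.GaloisRepresentations
  Literature.NumberTheory.IwasawaTheory
  Summit.BirchSwinnertonDyer.BirchSwinnertonDyer.Theorems.SteinbergFibreAtTwo
  Summit.BirchSwinnertonDyer.BirchSwinnertonDyer.Theorems.AlignedTransportAtTwoTorsionPointField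
  Summit.BirchSwinnertonDyer.BirchSwinnertonDyer.Theses.ByReductionTypeAtTwo

/-! ## The cubic field of discriminant `-756` — odd-index generator `X³ + (-6)X² + (9)X + (14)` (`[𝓞 : ℤ[θ]] = 3`; eng-2's polredabs cubic `X³ + (0)X² + (-6)X + (-12)` has EVEN
index `2`, unusable at `2`; `θ = (4) + (0)·θ₀ + (-1/2)·θ₀²`); C4″ rows 205632cw1 -/

/-- `X³ + (-6)X² + (9)X + (14)` is irreducible over `ℚ` (no root mod `5`). -/
theorem irreducible_cubic_d756n : Irreducible (Cubic.toPoly ⟨1, ((-6 : ℤ) : ℚ), ((9 : ℤ) : ℚ), ((14 : ℤ) : ℚ)⟩) :=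
  haveI : Fact (Nat.Prime 5) := ⟨by norm_num⟩
  irreducible_cubic_of_no_root_zmod 5 (by decide)

/-- `X³ + (0)X² + (-6)X + (-12)` (the polredabs cubic of the same field) is irreducible over `ℚ` (no root mod `5`). -/
theorem irreducible_cubic_d756n_aux : Irreducible (Cubic.toPoly ⟨1, ((0 : ℤ) : ℚ), ((-6 : ℤ) : ℚ), ((-12 : ℤ) : ℚ)⟩) :=
  haveI : Fact (Nat.Prime 5) := ⟨by norm_num⟩
  irreducible_cubic_of_no_root_zmod 5 (by decide)

section Certd756n

variable (K : Type) [Field K] [NumberField K]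

/-- **`h` is ODD for every cubic number field whose integers contain a root `θ` of `X³ + (-6)X² + (9)X + (14)`** (`|disc| = 6804 = 3²·756`,
`|d_K| ≤ 756` by the index-`3` element `θ₀`, `M_K < 8`): a norm certificate — for every prime `ℓ < 8` and every root `a` of the cubic mod `ℓ` a generator
`(x + yθ + zθ²)/m ∈ 𝓞 K` of the ideal `I ∋ ℓ, θ − a` of norm `ℓ` (5 witnesses; 0 with `m = 3` outside `ℤ[θ]`; the prime(s) dividing the index `3` through the
second generator `θ₀` of `𝓞 K` (`exists_intElem_of_scaled_cubic`), 1 witnesses). Found by the seat's relation sieve (Hermite normal form over the `S`-unit lattice) and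
CHECKED HERE by the kernel (`pow_three_eq_span_of_cert`, `Or.inl`). eng-2's PARI value (bnfcertify): `h = 1`. KERNEL. [cite: Marcus1977, Ch. 5 Thm. 35–37 and Cor. 2] [cite: Cohen1993, §6.3] -/
theorem odd_classNumber_of_root_d756n (h3 : Module.finrank ℚ K = 3) (b : 𝓞 K)
    (hb : b ^ 3 + (-6 : ℤ) * b ^ 2 + (9 : ℤ) * b + (14 : ℤ) = 0) : Odd (NumberField.classNumber K) := by
  have hirr := irreducible_cubic_d756n
  -- second generator `b2 = ((4) + (-5)θ + (1)θ²)/3 = θ₀`, a root of `X³ + (0)X² + (-6)X + (-12)` (index `2`, prime to `3`)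
  obtain ⟨b2, hb2m, hb2⟩ := exists_intElem_of_scaled_cubic K b (4) (-5) (1) (m := 3) (by norm_num) (0) (-6) (-12)
    (by push_cast; linear_combination (((-34 : ℤ) : 𝓞 K) + ((24 : ℤ) : 𝓞 K) * b + ((-9 : ℤ) : 𝓞 K) * b ^ 2 + ((1 : ℤ) : 𝓞 K) * b ^ 3 + ((0 : ℤ) : 𝓞 K) * b ^ 4) * hb)
  have hd : |NumberField.discr K| ≤ (756 : ℕ) :=
    abs_discr_le_of_sq_mul_le K (k := 3) (by norm_num)
      (sq_mul_abs_discr_le_abs_cubic_discr K h3 b hirr hb (by norm_num) (4) (-5) (1) ⟨b2, hb2m⟩ (by norm_num))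
      (by simp only [Cubic.discr]; norm_num)
  have hirr2 := irreducible_cubic_d756n_aux
  refine odd_classNumber_of_cubeCertificate K h3 (B := 8)
    (minkowskiBound_lt_of_sqrt_le K h3 hd (s := 27.50)
      ((Real.sqrt_le_sqrt (by norm_num : ((756 : ℕ) : ℝ) ≤ (27.50 : ℝ) ^ 2)).trans (Real.sqrt_sq (by norm_num)).le)
      (by norm_num)) ?_
  intro ℓ hℓB hℓ J hJ
  interval_cases ℓ <;> norm_num at hℓ
  · -- `ℓ = 2`: roots [0, 1]
    refine pow_three_eq_span_of_cert K h3 b hirr hb (by norm_num) (fun a ha hdvd => ?_) hJ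
    interval_cases a <;> norm_num at hdvd
    · exact Or.inl ⟨(184), (-83), (12), 1, by norm_num, by norm_num, ⟨_, by rw [Nat.cast_one, one_mul]⟩, by norm_num⟩
    · exact Or.inl ⟨(-1), (-1), (0), 1, by norm_num, by norm_num, ⟨_, by rw [Nat.cast_one, one_mul]⟩, by norm_num⟩
  · -- `ℓ = 3` divides the index of `ℤ[θ]`: second generator `b2`, roots [0]
    refine pow_three_eq_span_of_cert K h3 b2 hirr2 hb2 (by norm_num) (fun a ha hdvd => ?_) hJ
    interval_cases a <;> norm_num at hdvd
    · exact Or.inl ⟨(3), (-1), (0), 1, by norm_num, by norm_num, ⟨_, by rw [Nat.cast_one, one_mul]⟩, by norm_num⟩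
  · -- `ℓ = 5`: roots []
    refine pow_three_eq_span_of_cert K h3 b hirr hb (by norm_num) (fun a ha hdvd => ?_) hJ
    interval_cases a <;> norm_num at hdvd
  · -- `ℓ = 7`: roots [0, 3]
    refine pow_three_eq_span_of_cert K h3 b hirr hb (by norm_num) (fun a ha hdvd => ?_) hJ
    interval_cases a <;> norm_num at hdvd
    · exact Or.inl ⟨(-7), (-4), (4), 1, by norm_num, by norm_num, ⟨_, by rw [Nat.cast_one, one_mul]⟩, by norm_num⟩
    · exact Or.inl ⟨(31), (-14), (2), 1, by norm_num, by norm_num, ⟨_, by rw [Nat.cast_one, one_mul]⟩, by norm_num⟩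

end Certd756n

/-- **Iwasawa's `μ₂ = 0` for the cubic field of discriminant `-756`** (`ℚ(θ)`, `θ³ + (-6)θ² + (9)θ + (14) = 0`, index `3`; TWO primes above `2`,
`2 = 𝔭𝔮²`; `h` odd), KERNEL — every cyclotomic `ℤ₂`-extension of `ℚ(θ)` has `μ = 0` (growth form; indeed `e_n = 0` for all `n`).
Chevalley's door at `2` (k4-w1 `layerOneBit_of_chevalleyCert`): the fundamental unit `ε = ((-2497) + (1127)θ + (-163)θ²)/3` (regulator ≈ 7.11;
`ε³ + (1221)ε² + (-51)ε + (1) = 0`) has `ε ≡ 3 (mod 8)` under `θ ↦ z₂ ≡ 2` (`8 ∣ g(2)`, `g'(2)` odd), so `(ε, 2)_𝔭 = −1`: a non-norm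
from `ℚ(θ, √2)`, whence `e₁ = 0`; `≤ 2` primes above `2` by `4 ∤ g(0)`, `4 ∤ g(1)`; `e₀ = 0` by `odd_classNumber_of_root_d756n`; `n₀ = 0` by an even-index certificate in `ℤ[θ]` (`classicalMuVanishes_two_adjoin_of_evenIndexCertificate`); Fukuda 1994 Thm. 1 (1) (`_holds`).
The (I1M′) input of GEN 9's door for the C4″ rows 205632cw1. [cite: Fukuda1994, Thm. 1 (1), p. 264] [cite: Lang1990, Ch. 13 §4, Lemma 4.1]
[cite: Washington1997, §13.1] [cite: Greenberg2001IwasawaPastPresent, §4 (Iwasawa's μ-conjecture)] -/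
theorem classicalMu_two_cubicField_d756n {θ : AlgebraicClosure ℚ} (hθ : aeval θ (Cubic.toPoly ⟨1, ((-6 : ℤ) : ℚ), ((9 : ℤ) : ℚ), ((14 : ℤ) : ℚ)⟩) = 0) :
    haveI : FiniteDimensional ℚ (IntermediateField.adjoin ℚ {θ}) :=
      IntermediateField.adjoin.finiteDimensional ((AlgebraicClosure.isAlgebraic ℚ).isAlgebraic θ).isIntegral
    haveI : NumberField (IntermediateField.adjoin ℚ {θ}) := NumberField.mk
    ∀ κL : ZpExtension (IntermediateField.adjoin ℚ {θ}) 2, κL.IsCyclotomic → ClassicalMuVanishes κL := by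
  intro κL hκL
  have hθ' : θ ^ 3 + (-6 : AlgebraicClosure ℚ) * θ ^ 2 + (9 : AlgebraicClosure ℚ) * θ + (14 : AlgebraicClosure ℚ) = 0 := by
    have := hθ
    simp only [Cubic.toPoly, map_one, one_mul, aeval_add, aeval_mul, aeval_C, aeval_X_pow, aeval_X,
      eq_ratCast, Rat.cast_intCast] at this
    push_cast at this
    linear_combination this
  have he : aeval (algebraMap ℚ (AlgebraicClosure ℚ) (((-2497 : ℤ) : ℚ) / ((3 : ℤ) : ℚ)) +
      algebraMap ℚ (AlgebraicClosure ℚ) (((1127 : ℤ) : ℚ) / ((3 : ℤ) : ℚ)) * θ +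
      algebraMap ℚ (AlgebraicClosure ℚ) (((-163 : ℤ) : ℚ) / ((3 : ℤ) : ℚ)) * θ ^ 2)
      (Cubic.toPoly ⟨1, ((1221 : ℤ) : ℚ), ((-51 : ℤ) : ℚ), ((1 : ℤ) : ℚ)⟩) = 0 := by
    simp only [Cubic.toPoly, map_one, one_mul, aeval_add, aeval_mul, aeval_C, aeval_X_pow, aeval_X, eq_ratCast,
      Rat.cast_intCast, Rat.cast_div]
    push_cast
    field_simp
    linear_combination ((519369046 : AlgebraicClosure ℚ) + (-300750648 : AlgebraicClosure ℚ) * θ + (63845307 : AlgebraicClosure ℚ) * θ ^ 2 + (-4330747 : AlgebraicClosure ℚ) * θ ^ 3) * hθ'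
  have hh := not_two_dvd_card_classGroup_adjoin_of_forall_cubicField_odd irreducible_cubic_d756n (odd_classNumber_of_root_d756n) hθ
  have h1 := layerOneBit_of_chevalleyCert irreducible_cubic_d756n hθ hh ⟨0, by norm_num⟩ ⟨0, by norm_num⟩
      (-2497) (1127) (-163) (3) (1221) (-51) (1) (by norm_num) he (2) (3) (by norm_num) (by norm_num) (by decide) (by decide)
  have hirr := irreducible_cubic_d756n
  haveI : FiniteDimensional ℚ (IntermediateField.adjoin ℚ {θ}) :=
    IntermediateField.adjoin.finiteDimensional ((AlgebraicClosure.isAlgebraic ℚ).isAlgebraic θ).isIntegral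
  haveI : NumberField (IntermediateField.adjoin ℚ {θ}) := NumberField.mk
  obtain ⟨B, -, hB⟩ := exists_ringOfIntegers_cubic_root (p := -6) (q := 9) (r := 14) hθ
  have h3 := finrank_adjoin_eq_three_of_irreducible hirr hθ
  refine classicalMuVanishes_two_adjoin_of_evenIndexCertificate (p := -6) (q := 9) (r := 14) hirr hθ
    (((0 : ℤ) : 𝓞 (IntermediateField.adjoin ℚ {θ})) + ((-2 : ℤ) : 𝓞 (IntermediateField.adjoin ℚ {θ})) * B + ((0 : ℤ) : 𝓞 (IntermediateField.adjoin ℚ {θ})) * B ^ 2) (((0 : ℤ) : 𝓞 (IntermediateField.adjoin ℚ {θ})) + ((-1 : ℤ) : 𝓞 (IntermediateField.adjoin ℚ {θ})) * B + ((-1 : ℤ) : 𝓞 (IntermediateField.adjoin ℚ {θ})) * B ^ 2) (((56 : ℤ) : 𝓞 (IntermediateField.adjoin ℚ {θ})) + ((43 : ℤ) : 𝓞 (IntermediateField.adjoin ℚ {θ})) * B + ((-19 : ℤ) : 𝓞 (IntermediateField.adjoin ℚ {θ})) * B ^ 2) (((-2156 : ℤ) : 𝓞 (IntermediateField.adjoin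 ℚ {θ})) + ((-2513 : ℤ) : 𝓞 (IntermediateField.adjoin ℚ {θ})) * B + ((-168 : ℤ) : 𝓞 (IntermediateField.adjoin ℚ {θ})) * B ^ 2) ?_ ?_ ?_
    hh κL hκL (h1 κL hκL)
  · push_cast; linear_combination (((-16 : ℤ) : 𝓞 (IntermediateField.adjoin ℚ {θ})) + ((-2 : ℤ) : 𝓞 (IntermediateField.adjoin ℚ {θ})) * B + ((0 : ℤ) : 𝓞 (IntermediateField.adjoin ℚ {θ})) * B ^ 2) * hB
  · push_cast; linear_combination (((532 : ℤ) : 𝓞 (IntermediateField.adjoin ℚ {θ})) + ((361 : ℤ) : 𝓞 (IntermediateField.adjoin ℚ {θ})) * B + ((0 : ℤ) : 𝓞 (IntermediateField.adjoin ℚ {θ})) * B ^ 2) * hB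
  · have hz : (2 : 𝓞 (IntermediateField.adjoin ℚ {θ})) - (((-2156 : ℤ) : 𝓞 (IntermediateField.adjoin ℚ {θ})) + ((-2513 : ℤ) : 𝓞 (IntermediateField.adjoin ℚ {θ})) * B + ((-168 : ℤ) : 𝓞 (IntermediateField.adjoin ℚ {θ})) * B ^ 2) ^ 3 =
        ((-657982213068 : ℤ) : 𝓞 (IntermediateField.adjoin ℚ {θ})) + (-461168844969 : ℤ) * B + (283168528146 : ℤ) * B ^ 2 := by
      push_cast; linear_combination (((47714573249 : ℤ) : 𝓞 (IntermediateField.adjoin ℚ {θ})) + ((4770106488 : ℤ) : 𝓞 (IntermediateField.adjoin ℚ {θ})) * B + ((241230528 : ℤ) : 𝓞 (IntermediateField.adjoin ℚ {θ})) * B ^ 2 + ((4741632 : ℤ) : 𝓞 (IntermediateField.adjoin ℚ {θ})) * B ^ 3 + ((0 : ℤ) : 𝓞 (IntermediateField.adjoin ℚ {θ})) * B ^ 4) * hB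
    rw [hz]
    exact not_eight_dvd_norm_coords _ h3 B hirr hB (-657982213068) (-461168844969) (283168528146) (N := 14837774890509548965581714)
      (by simp only [Matrix.one_fin_three, Matrix.det_fin_three, Matrix.add_apply, Matrix.smul_apply, sq, Matrix.mul_apply,
        Fin.sum_univ_three, Matrix.of_apply, Matrix.cons_val', Matrix.cons_val_zero, Matrix.cons_val_one, Matrix.cons_val_two,
        Matrix.head_cons, Matrix.tail_cons, Matrix.empty_val', Matrix.cons_val_fin_one, smul_eq_mul]; norm_num) (by norm_num)

/-! ### Row `205632cw1` (cubic field `d = -756`) -/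

/-- The census cubic model of the C4″ row `205632cw1` (`y² = x³ + (0)x² + (-1500819948)x + (-22380524516016)`, addL2x GEN 13 `nst_census` a-invariants) is an elliptic curve. -/
theorem isElliptic_205632cw1' : (⟨0, ((0 : ℤ) : ℚ), 0, ((-1500819948 : ℤ) : ℚ), ((-22380524516016 : ℤ) : ℚ)⟩ : WeierstrassCurve ℚ).IsElliptic :=
  isElliptic_cubicModel _ _ _ (by simp only [Cubic.discr]; norm_num)

/-- **UNCONDITIONAL (A)₂ for the C4″ census curve `205632cw1` — ZERO hypotheses, ZERO named facts** (additive potentially multiplicative at `2`,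
irreducible `E[2]`, `Δ < 0`; `2`-torsion cubic field `ℚ(θ)`, `θ³ + (-6)θ² + (9)θ + (14) = 0`, `d = -6804`, `p q^2, F_q=Q2(sqrt3)`, `h` odd). Coates–Sujatha's
statement (A) at `p = 2` for the cubic model `y² = x³ + (0)x² + (-1500819948)x + (-22380524516016)`: for every cyclotomic `ℤ₂`-extension of `ℚ` the dual fine Selmer group
over `ℚ_∞` is finitely generated over `ℤ₂` (`∃ γ D` currency). KERNEL: `classicalMu_two_cubicField_d756n` above (μ₂(ℚ(θ)_cyc) = 0 for the field of `X³ + (-6)X² + (9)X + (14)`) ⟹ cruxlead-19573-w2's `ℓ = 2` ascent to the totally complex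
`ℚ(E[2]) = ℚ(θ, √d)` and kernel Lim 3.5@2 (`TotallyComplexMu.conjA_two_cubicModel_of_classicalMu_of_discr_neg`); the root `β = x(T)` of the curve's cubic is
`23412 + (-20616)θ + (2970)θ²` and `ℚ(β) = ℚ(θ)`. This discharges the (I1M′) input of this row (GEN 9 `hAnaMI_negDisc_of_cubicFieldMu`) in the kernel;
it is statement (A), NOT BSD: BSD₂ for `205632cw1` is NOT proved by this. [cite: CoatesSujatha2005, Conj. A and Thm. 3.4]
[cite: Iwasawa1973MuInvariants, Thm. 2 and Thm. 3] [cite: Fukuda1994, Thm. 1 (1), p. 264] [cite: Lang1990, Ch. 13 §4, Lemma 4.1] -/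
theorem conjA_two_205632cw1' (κ : ZpExtension ℚ 2) (hκ : κ.IsCyclotomic) :
    haveI := isElliptic_205632cw1'
    ∃ (γ : absoluteGaloisGroup ℚ) (D : (⟨0, ((0 : ℤ) : ℚ), 0, ((-1500819948 : ℤ) : ℚ), ((-22380524516016 : ℤ) : ℚ)⟩ : WeierstrassCurve ℚ).FineSelmerDualData κ γ),
      Module.Finite ℤ_[2] (RestrictScalars ℤ_[2] (IwasawaAlgebra 2) D.X) := by
  haveI := isElliptic_205632cw1'
  obtain ⟨θ, hθ⟩ : ∃ θ : AlgebraicClosure ℚ, aeval θ (Cubic.toPoly ⟨1, ((-6 : ℤ) : ℚ), ((9 : ℤ) : ℚ), ((14 : ℤ) : ℚ)⟩) = 0 :=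
    IsAlgClosed.exists_aeval_eq_zero _ _ (by rw [Cubic.degree_of_a_ne_zero one_ne_zero]; norm_num)
  have hθ' : θ ^ 3 + (-6 : AlgebraicClosure ℚ) * θ ^ 2 + (9 : AlgebraicClosure ℚ) * θ + (14 : AlgebraicClosure ℚ) = 0 := by
    have := hθ
    simp only [Cubic.toPoly, map_one, one_mul, aeval_add, aeval_mul, aeval_C, aeval_X_pow, aeval_X,
      eq_ratCast, Rat.cast_intCast] at this
    push_cast at this
    linear_combination this
  set β : AlgebraicClosure ℚ := algebraMap ℚ (AlgebraicClosure ℚ) (23412 : ℚ) +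
      algebraMap ℚ (AlgebraicClosure ℚ) (-20616 : ℚ) * θ + algebraMap ℚ (AlgebraicClosure ℚ) (2970 : ℚ) * θ ^ 2 with hβdef
  have hβ : aeval β (Cubic.toPoly ⟨1, ((0 : ℤ) : ℚ), ((-1500819948 : ℤ) : ℚ), ((-22380524516016 : ℤ) : ℚ)⟩) = 0 := by
    simp only [Cubic.toPoly, map_one, one_mul, aeval_add, aeval_mul, aeval_C, aeval_X_pow, aeval_X, eq_ratCast,
      Rat.cast_intCast]
    rw [hβdef]
    simp only [eq_ratCast]
    push_cast
    linear_combination ((-3191792490576 : AlgebraicClosure ℚ) + (1840485917160 : AlgebraicClosure ℚ) * θ + (-388366585200 : AlgebraicClosure ℚ) * θ ^ 2 + (26198073000 : AlgebraicClosure ℚ) * θ ^ 3) * hθ'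
  have hadj : IntermediateField.adjoin ℚ {β} = IntermediateField.adjoin ℚ {θ} := by
    apply le_antisymm
    · rw [IntermediateField.adjoin_simple_le_iff, hβdef]
      have hθmem := IntermediateField.mem_adjoin_simple_self ℚ θ
      exact add_mem (add_mem (algebraMap_mem _ _) (mul_mem (algebraMap_mem _ _) hθmem))
        (mul_mem (algebraMap_mem _ _) (pow_mem hθmem 2))
    · rw [IntermediateField.adjoin_simple_le_iff]
      have hθeq : θ = algebraMap ℚ (AlgebraicClosure ℚ) (-6802998479/37879808 : ℚ) +
          algebraMap ℚ (AlgebraicClosure ℚ) (-1874911/454557696 : ℚ) * β +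
          algebraMap ℚ (AlgebraicClosure ℚ) (55/303038464 : ℚ) * β ^ 2 := by
        rw [hβdef]; simp only [eq_ratCast]; push_cast
        linear_combination (((478043775 : AlgebraicClosure ℚ) / 37879808) + ((-121287375 : AlgebraicClosure ℚ) / 75759616) * θ) * hθ'
      rw [hθeq]
      have hβmem := IntermediateField.mem_adjoin_simple_self ℚ β
      exact add_mem (add_mem (algebraMap_mem _ _) (mul_mem (algebraMap_mem _ _) hβmem))
        (mul_mem (algebraMap_mem _ _) (pow_mem hβmem 2))
  have h3 : Module.finrank ℚ (IntermediateField.adjoin ℚ {β}) = 3 := by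
    rw [hadj]; exact finrank_adjoin_eq_three_of_irreducible irreducible_cubic_d756n hθ
  exact TotallyComplexMu.conjA_two_cubicModel_of_classicalMu_of_discr_neg (0) (-1500819948) (-22380524516016)
    (irreducible_cubic_of_finrank_adjoin_eq_three hβ h3) (by simp only [Cubic.discr]; norm_num) hβ
    (by rw [hadj]; exact classicalMu_two_cubicField_d756n hθ) κ hκ

/-! ## The cubic field of discriminant `-2420` — odd-index generator `X³ + (-7)X² + (20)X + (26)` (`[𝓞 : ℤ[θ]] = 5`; eng-2's polredabs cubic `X³ + (0)X² + (-22)X + (-44)` has EVEN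
index `2`, unusable at `2`; `θ = (-5) + (-2)·θ₀ + (1/2)·θ₀²`); C4″ rows 193600fd1 -/

/-- `X³ + (-7)X² + (20)X + (26)` is irreducible over `ℚ` (no root mod `3`). -/
theorem irreducible_cubic_d2420n : Irreducible (Cubic.toPoly ⟨1, ((-7 : ℤ) : ℚ), ((20 : ℤ) : ℚ), ((26 : ℤ) : ℚ)⟩) :=
  haveI : Fact (Nat.Prime 3) := ⟨by norm_num⟩
  irreducible_cubic_of_no_root_zmod 3 (by decide)

/-- `X³ + (0)X² + (-22)X + (-44)` (the polredabs cubic of the same field) is irreducible over `ℚ` (no root mod `3`). -/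
theorem irreducible_cubic_d2420n_aux : Irreducible (Cubic.toPoly ⟨1, ((0 : ℤ) : ℚ), ((-22 : ℤ) : ℚ), ((-44 : ℤ) : ℚ)⟩) :=
  haveI : Fact (Nat.Prime 3) := ⟨by norm_num⟩
  irreducible_cubic_of_no_root_zmod 3 (by decide)

section Certd2420n

variable (K : Type) [Field K] [NumberField K]

/-- **`h` is ODD for every cubic number field whose integers contain a root `θ` of `X³ + (-7)X² + (20)X + (26)`** (`|disc| = 60500 = 5²·2420`,
`|d_K| ≤ 2420` by the index-`5` element `θ₀`, `M_K < 14`): a norm certificate — for every prime `ℓ < 14` and every root `a` of the cubic mod `ℓ` a generator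
`(x + yθ + zθ²)/m ∈ 𝓞 K` of the ideal `I ∋ ℓ, θ − a` of norm `ℓ` (6 witnesses; 0 with `m = 5` outside `ℤ[θ]`; the prime(s) dividing the index `5` through the
second generator `θ₀` of `𝓞 K` (`exists_intElem_of_scaled_cubic`), 2 witnesses). Found by the seat's relation sieve (Hermite normal form over the `S`-unit lattice) and
CHECKED HERE by the kernel (`pow_three_eq_span_of_cert`, `Or.inl`). eng-2's PARI value (bnfcertify): `h = 1`. KERNEL. [cite: Marcus1977, Ch. 5 Thm. 35–37 and Cor. 2] [cite: Cohen1993, §6.3] -/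
theorem odd_classNumber_of_root_d2420n (h3 : Module.finrank ℚ K = 3) (b : 𝓞 K)
    (hb : b ^ 3 + (-7 : ℤ) * b ^ 2 + (20 : ℤ) * b + (26 : ℤ) = 0) : Odd (NumberField.classNumber K) := by
  have hirr := irreducible_cubic_d2420n
  -- second generator `b2 = ((18) + (-9)θ + (1)θ²)/5 = θ₀`, a root of `X³ + (0)X² + (-22)X + (-44)` (index `2`, prime to `5`)
  obtain ⟨b2, hb2m, hb2⟩ := exists_intElem_of_scaled_cubic K b (18) (-9) (1) (m := 5) (by norm_num) (0) (-22) (-44)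
    (by push_cast; linear_combination (((-368 : ℤ) : 𝓞 K) + ((137 : ℤ) : 𝓞 K) * b + ((-20 : ℤ) : 𝓞 K) * b ^ 2 + ((1 : ℤ) : 𝓞 K) * b ^ 3 + ((0 : ℤ) : 𝓞 K) * b ^ 4) * hb)
  have hd : |NumberField.discr K| ≤ (2420 : ℕ) :=
    abs_discr_le_of_sq_mul_le K (k := 5) (by norm_num)
      (sq_mul_abs_discr_le_abs_cubic_discr K h3 b hirr hb (by norm_num) (18) (-9) (1) ⟨b2, hb2m⟩ (by norm_num))
      (by simp only [Cubic.discr]; norm_num)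
  have hirr2 := irreducible_cubic_d2420n_aux
  refine odd_classNumber_of_cubeCertificate K h3 (B := 14)
    (minkowskiBound_lt_of_sqrt_le K h3 hd (s := 49.20)
      ((Real.sqrt_le_sqrt (by norm_num : ((2420 : ℕ) : ℝ) ≤ (49.20 : ℝ) ^ 2)).trans (Real.sqrt_sq (by norm_num)).le)
      (by norm_num)) ?_
  intro ℓ hℓB hℓ J hJ
  interval_cases ℓ <;> norm_num at hℓ
  · -- `ℓ = 2`: roots [0, 1]
    refine pow_three_eq_span_of_cert K h3 b hirr hb (by norm_num) (fun a ha hdvd => ?_) hJ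
    interval_cases a <;> norm_num at hdvd
    · exact Or.inl ⟨(54628516118526), (-15777644389281), (1985824105322), 1, by norm_num, by norm_num, ⟨_, by rw [Nat.cast_one, one_mul]⟩, by norm_num⟩
    · exact Or.inl ⟨(-1), (-1), (0), 1, by norm_num, by norm_num, ⟨_, by rw [Nat.cast_one, one_mul]⟩, by norm_num⟩
  · -- `ℓ = 3`: roots []
    refine pow_three_eq_span_of_cert K h3 b hirr hb (by norm_num) (fun a ha hdvd => ?_) hJ
    interval_cases a <;> norm_num at hdvd
  · -- `ℓ = 5` divides the index of `ℤ[θ]`: second generator `b2`, roots [1, 2]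
    refine pow_three_eq_span_of_cert K h3 b2 hirr2 hb2 (by norm_num) (fun a ha hdvd => ?_) hJ
    interval_cases a <;> norm_num at hdvd
    · exact Or.inl ⟨(-19), (-2), (1), 1, by norm_num, by norm_num, ⟨_, by rw [Nat.cast_one, one_mul]⟩, by norm_num⟩
    · exact Or.inl ⟨(-3), (-1), (0), 1, by norm_num, by norm_num, ⟨_, by rw [Nat.cast_one, one_mul]⟩, by norm_num⟩
  · -- `ℓ = 7`: roots []
    refine pow_three_eq_span_of_cert K h3 b hirr hb (by norm_num) (fun a ha hdvd => ?_) hJ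
    interval_cases a <;> norm_num at hdvd
  · -- `ℓ = 11`: roots [6]
    refine pow_three_eq_span_of_cert K h3 b hirr hb (by norm_num) (fun a ha hdvd => ?_) hJ
    interval_cases a <;> norm_num at hdvd
    · exact Or.inl ⟨(883570503), (-255190186), (32119042), 1, by norm_num, by norm_num, ⟨_, by rw [Nat.cast_one, one_mul]⟩, by norm_num⟩
  · -- `ℓ = 13`: roots [0]
    refine pow_three_eq_span_of_cert K h3 b hirr hb (by norm_num) (fun a ha hdvd => ?_) hJ
    interval_cases a <;> norm_num at hdvd
    · exact Or.inl ⟨(-1416329892835), (409060157127), (-51485602065), 1, by norm_num, by norm_num, ⟨_, by rw [Nat.cast_one, one_mul]⟩, by norm_num⟩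

end Certd2420n

/-- **Iwasawa's `μ₂ = 0` for the cubic field of discriminant `-2420`** (`ℚ(θ)`, `θ³ + (-7)θ² + (20)θ + (26) = 0`, index `5`; TWO primes above `2`,
`2 = 𝔭𝔮²`; `h` odd), KERNEL — every cyclotomic `ℤ₂`-extension of `ℚ(θ)` has `μ = 0` (growth form; indeed `e_n = 0` for all `n`).
Chevalley's door at `2` (k4-w1 `layerOneBit_of_chevalleyCert`): the fundamental unit `ε = ((-648833) + (187394)θ + (-23586)θ²)/5` (regulator ≈ 12.04;
`ε³ + (169403)ε² + (795)ε + (1) = 0`) has `ε ≡ 3 (mod 8)` under `θ ↦ z₂ ≡ 1` (`8 ∣ g(1)`, `g'(1)` odd), so `(ε, 2)_𝔭 = −1`: a non-norm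
from `ℚ(θ, √2)`, whence `e₁ = 0`; `≤ 2` primes above `2` by `4 ∤ g(0)`, `4 ∤ g(3)`; `e₀ = 0` by `odd_classNumber_of_root_d2420n`; `n₀ = 0` by an even-index certificate in `ℤ[θ]` (`classicalMuVanishes_two_adjoin_of_evenIndexCertificate`); Fukuda 1994 Thm. 1 (1) (`_holds`).
The (I1M′) input of GEN 9's door for the C4″ rows 193600fd1. [cite: Fukuda1994, Thm. 1 (1), p. 264] [cite: Lang1990, Ch. 13 §4, Lemma 4.1]
[cite: Washington1997, §13.1] [cite: Greenberg2001IwasawaPastPresent, §4 (Iwasawa's μ-conjecture)] -/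
theorem classicalMu_two_cubicField_d2420n {θ : AlgebraicClosure ℚ} (hθ : aeval θ (Cubic.toPoly ⟨1, ((-7 : ℤ) : ℚ), ((20 : ℤ) : ℚ), ((26 : ℤ) : ℚ)⟩) = 0) :
    haveI : FiniteDimensional ℚ (IntermediateField.adjoin ℚ {θ}) :=
      IntermediateField.adjoin.finiteDimensional ((AlgebraicClosure.isAlgebraic ℚ).isAlgebraic θ).isIntegral
    haveI : NumberField (IntermediateField.adjoin ℚ {θ}) := NumberField.mk
    ∀ κL : ZpExtension (IntermediateField.adjoin ℚ {θ}) 2, κL.IsCyclotomic → ClassicalMuVanishes κL := by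
  intro κL hκL
  have hθ' : θ ^ 3 + (-7 : AlgebraicClosure ℚ) * θ ^ 2 + (20 : AlgebraicClosure ℚ) * θ + (26 : AlgebraicClosure ℚ) = 0 := by
    have := hθ
    simp only [Cubic.toPoly, map_one, one_mul, aeval_add, aeval_mul, aeval_C, aeval_X_pow, aeval_X,
      eq_ratCast, Rat.cast_intCast] at this
    push_cast at this
    linear_combination this
  have he : aeval (algebraMap ℚ (AlgebraicClosure ℚ) (((-648833 : ℤ) : ℚ) / ((5 : ℤ) : ℚ)) +
      algebraMap ℚ (AlgebraicClosure ℚ) (((187394 : ℤ) : ℚ) / ((5 : ℤ) : ℚ)) * θ +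
      algebraMap ℚ (AlgebraicClosure ℚ) (((-23586 : ℤ) : ℚ) / ((5 : ℤ) : ℚ)) * θ ^ 2)
      (Cubic.toPoly ⟨1, ((169403 : ℤ) : ℚ), ((795 : ℤ) : ℚ), ((1 : ℤ) : ℚ)⟩) = 0 := by
    simp only [Cubic.toPoly, map_one, one_mul, aeval_add, aeval_mul, aeval_C, aeval_X_pow, aeval_X, eq_ratCast,
      Rat.cast_intCast, Rat.cast_div]
    push_cast
    field_simp
    linear_combination ((3208903465158848 : AlgebraicClosure ℚ) + (-1287731286921672 : AlgebraicClosure ℚ) * θ + (220895364163680 : AlgebraicClosure ℚ) * θ ^ 2 + (-13120877554056 : AlgebraicClosure ℚ) * θ ^ 3) * hθ'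
  have hh := not_two_dvd_card_classGroup_adjoin_of_forall_cubicField_odd irreducible_cubic_d2420n (odd_classNumber_of_root_d2420n) hθ
  have h1 := layerOneBit_of_chevalleyCert irreducible_cubic_d2420n hθ hh ⟨0, by norm_num⟩ ⟨1, by norm_num⟩
      (-648833) (187394) (-23586) (5) (169403) (795) (1) (by norm_num) he (1) (5) (by norm_num) (by norm_num) (by decide) (by decide)
  have hirr := irreducible_cubic_d2420n
  haveI : FiniteDimensional ℚ (IntermediateField.adjoin ℚ {θ}) :=
    IntermediateField.adjoin.finiteDimensional ((AlgebraicClosure.isAlgebraic ℚ).isAlgebraic θ).isIntegral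
  haveI : NumberField (IntermediateField.adjoin ℚ {θ}) := NumberField.mk
  obtain ⟨B, -, hB⟩ := exists_ringOfIntegers_cubic_root (p := -7) (q := 20) (r := 26) hθ
  have h3 := finrank_adjoin_eq_three_of_irreducible hirr hθ
  refine classicalMuVanishes_two_adjoin_of_evenIndexCertificate (p := -7) (q := 20) (r := 26) hirr hθ
    (((-2 : ℤ) : 𝓞 (IntermediateField.adjoin ℚ {θ})) + ((-2 : ℤ) : 𝓞 (IntermediateField.adjoin ℚ {θ})) * B + ((0 : ℤ) : 𝓞 (IntermediateField.adjoin ℚ {θ})) * B ^ 2) (((0 : ℤ) : 𝓞 (IntermediateField.adjoin ℚ {θ})) + ((-1 : ℤ) : 𝓞 (IntermediateField.adjoin ℚ {θ})) * B + ((-1 : ℤ) : 𝓞 (IntermediateField.adjoin ℚ {θ})) * B ^ 2) (((118 : ℤ) : 𝓞 (IntermediateField.adjoin ℚ {θ})) + ((105 : ℤ) : 𝓞 (IntermediateField.adjoin ℚ {θ})) * B + ((-21 : ℤ) : 𝓞 (IntermediateField.adjoin ℚ {θ})) * B ^ 2) (((24161 : ℤ) : 𝓞 (IntermediateField.adjoin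 ℚ {θ})) + ((19887 : ℤ) : 𝓞 (IntermediateField.adjoin ℚ {θ})) * B + ((-6006 : ℤ) : 𝓞 (IntermediateField.adjoin ℚ {θ})) * B ^ 2) ?_ ?_ ?_
    hh κL hκL (h1 κL hκL)
  · push_cast; linear_combination (((-18 : ℤ) : 𝓞 (IntermediateField.adjoin ℚ {θ})) + ((-2 : ℤ) : 𝓞 (IntermediateField.adjoin ℚ {θ})) * B + ((0 : ℤ) : 𝓞 (IntermediateField.adjoin ℚ {θ})) * B ^ 2) * hB
  · push_cast; linear_combination (((-1323 : ℤ) : 𝓞 (IntermediateField.adjoin ℚ {θ})) + ((441 : ℤ) : 𝓞 (IntermediateField.adjoin ℚ {θ})) * B + ((0 : ℤ) : 𝓞 (IntermediateField.adjoin ℚ {θ})) * B ^ 2) * hB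
  · have hz : (2 : 𝓞 (IntermediateField.adjoin ℚ {θ})) - (((24161 : ℤ) : 𝓞 (IntermediateField.adjoin ℚ {θ})) + ((19887 : ℤ) : 𝓞 (IntermediateField.adjoin ℚ {θ})) * B + ((-6006 : ℤ) : 𝓞 (IntermediateField.adjoin ℚ {θ})) * B ^ 2) ^ 3 =
        ((333393648635811 : ℤ) : 𝓞 (IntermediateField.adjoin ℚ {θ})) + (343510718658723 : ℤ) * B + (-9771800269140 : ℤ) * B ^ 2 := by
      push_cast; linear_combination (((-13365297196965 : ℤ) : 𝓞 (IntermediateField.adjoin ℚ {θ})) + ((-4270466053854 : ℤ) : 𝓞 (IntermediateField.adjoin ℚ {θ})) * B + ((-635553202284 : ℤ) : 𝓞 (IntermediateField.adjoin ℚ {θ})) * B ^ 2 + ((216648648216 : ℤ) : 𝓞 (IntermediateField.adjoin ℚ {θ})) * B ^ 3 + ((0 : ℤ) : 𝓞 (IntermediateField.adjoin ℚ {θ})) * B ^ 4) * hB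
    rw [hz]
    exact not_eight_dvd_norm_coords _ h3 B hirr hB (333393648635811) (343510718658723) (-9771800269140) (N := 7158666534298270875232235773650)
      (by simp only [Matrix.one_fin_three, Matrix.det_fin_three, Matrix.add_apply, Matrix.smul_apply, sq, Matrix.mul_apply,
        Fin.sum_univ_three, Matrix.of_apply, Matrix.cons_val', Matrix.cons_val_zero, Matrix.cons_val_one, Matrix.cons_val_two,
        Matrix.head_cons, Matrix.tail_cons, Matrix.empty_val', Matrix.cons_val_fin_one, smul_eq_mul]; norm_num) (by norm_num)

/-! ### Row `193600fd1` (cubic field `d = -2420`) -/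

/-- The census cubic model of the C4″ row `193600fd1` (`y² = x³ + (0)x² + (7320500)x + (-8052550000)`, addL2x GEN 13 `nst_census` a-invariants) is an elliptic curve. -/
theorem isElliptic_193600fd1' : (⟨0, ((0 : ℤ) : ℚ), 0, ((7320500 : ℤ) : ℚ), ((-8052550000 : ℤ) : ℚ)⟩ : WeierstrassCurve ℚ).IsElliptic :=
  isElliptic_cubicModel _ _ _ (by simp only [Cubic.discr]; norm_num)

/-- **UNCONDITIONAL (A)₂ for the C4″ census curve `193600fd1` — ZERO hypotheses, ZERO named facts** (additive potentially multiplicative at `2`,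
irreducible `E[2]`, `Δ < 0`; `2`-torsion cubic field `ℚ(θ)`, `θ³ + (-7)θ² + (20)θ + (26) = 0`, `d = -60500`, `p q^2, F_q=Q2(sqrt3)`, `h` odd). Coates–Sujatha's
statement (A) at `p = 2` for the cubic model `y² = x³ + (0)x² + (7320500)x + (-8052550000)`: for every cyclotomic `ℤ₂`-extension of `ℚ` the dual fine Selmer group
over `ℚ_∞` is finitely generated over `ℤ₂` (`∃ γ D` currency). KERNEL: `classicalMu_two_cubicField_d2420n` above (μ₂(ℚ(θ)_cyc) = 0 for the field of `X³ + (-7)X² + (20)X + (26)`) ⟹ cruxlead-19573-w2's `ℓ = 2` ascent to the totally complex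
`ℚ(E[2]) = ℚ(θ, √d)` and kernel Lim 3.5@2 (`TotallyComplexMu.conjA_two_cubicModel_of_classicalMu_of_discr_neg`); the root `β = x(T)` of the curve's cubic is
`462 + (-396)θ + (154)θ²` and `ℚ(β) = ℚ(θ)`. This discharges the (I1M′) input of this row (GEN 9 `hAnaMI_negDisc_of_cubicFieldMu`) in the kernel;
it is statement (A), NOT BSD: BSD₂ for `193600fd1` is NOT proved by this. [cite: CoatesSujatha2005, Conj. A and Thm. 3.4]
[cite: Iwasawa1973MuInvariants, Thm. 2 and Thm. 3] [cite: Fukuda1994, Thm. 1 (1), p. 264] [cite: Lang1990, Ch. 13 §4, Lemma 4.1] -/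
theorem conjA_two_193600fd1' (κ : ZpExtension ℚ 2) (hκ : κ.IsCyclotomic) :
    haveI := isElliptic_193600fd1'
    ∃ (γ : absoluteGaloisGroup ℚ) (D : (⟨0, ((0 : ℤ) : ℚ), 0, ((7320500 : ℤ) : ℚ), ((-8052550000 : ℤ) : ℚ)⟩ : WeierstrassCurve ℚ).FineSelmerDualData κ γ),
      Module.Finite ℤ_[2] (RestrictScalars ℤ_[2] (IwasawaAlgebra 2) D.X) := by
  haveI := isElliptic_193600fd1'
  obtain ⟨θ, hθ⟩ : ∃ θ : AlgebraicClosure ℚ, aeval θ (Cubic.toPoly ⟨1, ((-7 : ℤ) : ℚ), ((20 : ℤ) : ℚ), ((26 : ℤ) : ℚ)⟩) = 0 :=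
    IsAlgClosed.exists_aeval_eq_zero _ _ (by rw [Cubic.degree_of_a_ne_zero one_ne_zero]; norm_num)
  have hθ' : θ ^ 3 + (-7 : AlgebraicClosure ℚ) * θ ^ 2 + (20 : AlgebraicClosure ℚ) * θ + (26 : AlgebraicClosure ℚ) = 0 := by
    have := hθ
    simp only [Cubic.toPoly, map_one, one_mul, aeval_add, aeval_mul, aeval_C, aeval_X_pow, aeval_X,
      eq_ratCast, Rat.cast_intCast] at this
    push_cast at this
    linear_combination this
  set β : AlgebraicClosure ℚ := algebraMap ℚ (AlgebraicClosure ℚ) (462 : ℚ) +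
      algebraMap ℚ (AlgebraicClosure ℚ) (-396 : ℚ) * θ + algebraMap ℚ (AlgebraicClosure ℚ) (154 : ℚ) * θ ^ 2 with hβdef
  have hβ : aeval β (Cubic.toPoly ⟨1, ((0 : ℤ) : ℚ), ((7320500 : ℤ) : ℚ), ((-8052550000 : ℤ) : ℚ)⟩) = 0 := by
    simp only [Cubic.toPoly, map_one, one_mul, aeval_add, aeval_mul, aeval_C, aeval_X_pow, aeval_X, eq_ratCast,
      Rat.cast_intCast]
    rw [hβdef]
    simp only [eq_ratCast]
    push_cast
    linear_combination ((-175841072 : AlgebraicClosure ℚ) + (14012768 : AlgebraicClosure ℚ) * θ + (-2608760 : AlgebraicClosure ℚ) * θ ^ 2 + (3652264 : AlgebraicClosure ℚ) * θ ^ 3) * hθ'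
  have hadj : IntermediateField.adjoin ℚ {β} = IntermediateField.adjoin ℚ {θ} := by
    apply le_antisymm
    · rw [IntermediateField.adjoin_simple_le_iff, hβdef]
      have hθmem := IntermediateField.mem_adjoin_simple_self ℚ θ
      exact add_mem (add_mem (algebraMap_mem _ _) (mul_mem (algebraMap_mem _ _) hθmem))
        (mul_mem (algebraMap_mem _ _) (pow_mem hθmem 2))
    · rw [IntermediateField.adjoin_simple_le_iff]
      have hθeq : θ = algebraMap ℚ (AlgebraicClosure ℚ) (-7/8 : ℚ) +
          algebraMap ℚ (AlgebraicClosure ℚ) (1/1760 : ℚ) * β +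
          algebraMap ℚ (AlgebraicClosure ℚ) (-7/10648000 : ℚ) * β ^ 2 := by
        rw [hβdef]; simp only [eq_ratCast]; push_cast
        linear_combination (((637 : AlgebraicClosure ℚ) / 22000) + ((343 : AlgebraicClosure ℚ) / 22000) * θ) * hθ'
      rw [hθeq]
      have hβmem := IntermediateField.mem_adjoin_simple_self ℚ β
      exact add_mem (add_mem (algebraMap_mem _ _) (mul_mem (algebraMap_mem _ _) hβmem))
        (mul_mem (algebraMap_mem _ _) (pow_mem hβmem 2))
  have h3 : Module.finrank ℚ (IntermediateField.adjoin ℚ {β}) = 3 := by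
    rw [hadj]; exact finrank_adjoin_eq_three_of_irreducible irreducible_cubic_d2420n hθ
  exact TotallyComplexMu.conjA_two_cubicModel_of_classicalMu_of_discr_neg (0) (7320500) (-8052550000)
    (irreducible_cubic_of_finrank_adjoin_eq_three hβ h3) (by simp only [Cubic.discr]; norm_num) hβ
    (by rw [hadj]; exact classicalMu_two_cubicField_d2420n hθ) κ hκ
end Summit.BirchSwinnertonDyer.BirchSwinnertonDyer.Theorems.AddKatoTwo

end
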